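import Mathlib.RingTheory.Smooth.Fiber
import Mathlib.RingTheory.Unramified.LocalRing
import HarnessLib

/-!
# Étale at a point: flat, with the fibre a separable (residue) field

Topic: `Literature/AlgebraicGeometry/Resolution`. A pointwise form of "flat and unramified ⇒
étale" (Stacks 08WD / 02GU), for an `A`-algebra `S` of finite presentation and a prime `𝔔` of
`S` over `𝔭 ⊂ A`: if `S_𝔔` is flat over `A`, the fibre `S_𝔔 / 𝔭 S_𝔔` is a field, and the residue
field extension `κ(𝔭) ⊆ κ(𝔔)` is separable, then `S` is étale at `𝔔` (`Algebra.IsEtaleAt`,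
i.e. `A → S_𝔔` formally étale). This is the local computation of de Jong 1996, proof of
Lemma 4.13 ("Therefore `f|_H : H → Y` is finite étale over a neighbourhood of `y`") once the
flatness of `𝒪_{H,x}` over `𝒪_{Y,y}` (the slicing criterion, `FlatSlicingCriterion.lean`) and
`𝒪_{H,x}/𝔪_y 𝒪_{H,x} = κ(y)` are known; it is assembled from Mathlib's fibre criteria:

* unramified: `Algebra.isUnramifiedAt_iff_map_eq` (`pS_𝔔 = 𝔔S_𝔔` and `κ(𝔔)/κ(𝔭)` separable);
* formally smooth: `Algebra.FormallySmooth.of_formallySmooth_residueField_tensor` for the local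
  homomorphism `A_𝔭 → S_𝔔` (flat, essentially of finite presentation, fibre `k ⊗ S_𝔔 = κ(𝔔)`
  formally smooth over `k = κ(𝔭)` as a separable extension), then `A → A_𝔭 → S_𝔔`.

* `isEtaleAt_of_flat_of_isField_fiber` — the statement above.

## Sources

* The Stacks Project, Tag 08WD ((3) ⇒ (1)) and Tag 00TF. [StacksProject]
* A. J. de Jong, *Smoothness, semi-stability and alterations*, Publ. Math. IHÉS 83 (1996),
  Lemma 4.13 (proof), p. 70. [DeJong1996]
-/

noncomputable section

open IsLocalRing TensorProduct

namespace Literature.AlgebraicGeometry.Resolution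

universe u v

variable {A : Type u} {S : Type v} [CommRing A] [CommRing S] [Algebra A S]

/-- For a local homomorphism `(R, 𝔪) → (T, 𝔫)` with `𝔪T = 𝔫` and `κ(T)/κ(R)` separable, the
fibre `κ(R) ⊗_R T` is formally smooth over `κ(R)`: it is `T/𝔪T = κ(T)`. [folklore] -/
theorem formallySmooth_residueField_tensor_of_map_maximalIdeal {R T : Type*} [CommRing R]
    [CommRing T] [Algebra R T] [IsLocalRing R] [IsLocalRing T] [IsLocalHom (algebraMap R T)]
    [Algebra.IsSeparable (ResidueField R) (ResidueField T)]
    (H : (maximalIdeal R).map (algebraMap R T) = maximalIdeal T) :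
    Algebra.FormallySmooth (ResidueField R) (ResidueField R ⊗[R] T) := by
  -- `L = T / 𝔪T`, a `κ(R) = R/𝔪`-algebra isomorphic to `κ(T)`
  letI algL : Algebra (ResidueField R) (T ⧸ (maximalIdeal R).map (algebraMap R T)) :=
    (inferInstance : Algebra (R ⧸ maximalIdeal R) (T ⧸ (maximalIdeal R).map (algebraMap R T)))
  -- the ring isomorphism `L ≃+* κ(T)` and its `κ(R)`-linearity
  let e₀ : (T ⧸ (maximalIdeal R).map (algebraMap R T)) ≃+* ResidueField T := Ideal.quotEquivOfEq H
  have he₀ : ∀ a : ResidueField R,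
      e₀ (algebraMap (ResidueField R) (T ⧸ (maximalIdeal R).map (algebraMap R T)) a) =
        algebraMap (ResidueField R) (ResidueField T) a := by
    intro a
    obtain ⟨a, rfl⟩ := Ideal.Quotient.mk_surjective a
    rfl
  let e : (T ⧸ (maximalIdeal R).map (algebraMap R T)) ≃ₐ[ResidueField R] ResidueField T :=
    AlgEquiv.ofRingEquiv (f := e₀) he₀
  haveI : Algebra.IsSeparable (ResidueField R) (T ⧸ (maximalIdeal R).map (algebraMap R T)) :=
    AlgEquiv.Algebra.isSeparable e.symm
  -- `L` is a field
  have hLf : IsField (T ⧸ (maximalIdeal R).map (algebraMap R T)) :=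
    MulEquiv.isField (Field.toIsField (ResidueField T)) e₀.toMulEquiv
  letI : Field (T ⧸ (maximalIdeal R).map (algebraMap R T)) := hLf.toField
  haveI : Algebra.FormallyEtale (ResidueField R) (T ⧸ (maximalIdeal R).map (algebraMap R T)) :=
    Algebra.FormallyEtale.of_isSeparable _ _
  haveI : Algebra.FormallySmooth (ResidueField R) (T ⧸ (maximalIdeal R).map (algebraMap R T)) :=
    inferInstance
  exact Algebra.FormallySmooth.of_equiv
    (Algebra.TensorProduct.quotIdealMapEquivQuotTensor T (maximalIdeal R))

/-- **Étale at a point from flatness and a separable field fibre** (pointwise Stacks 08WD): let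
`S` be an `A`-algebra of finite presentation and `𝔔 ⊂ S` a prime over `𝔭 ⊂ A` such that `S_𝔔`
is flat over `A`, the fibre `S_𝔔/𝔭S_𝔔` is a field, and `κ(𝔔)/κ(𝔭)` is separable. Then `S` is
étale at `𝔔`: unramified by `Algebra.isUnramifiedAt_iff_map_eq`, formally smooth over `A_𝔭` by
the fibre criterion `Algebra.FormallySmooth.of_formallySmooth_residueField_tensor` (the fibre
`κ(𝔭) ⊗ S_𝔔 = κ(𝔔)` being formally smooth over `κ(𝔭)`), hence over `A`.
[cite: StacksProject, Tag 08WD and Tag 00TF] -/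
theorem isEtaleAt_of_flat_of_isField_fiber [Algebra.FinitePresentation A S] (𝔭 : Ideal A)
    [𝔭.IsPrime] (𝔔 : Ideal S) [𝔔.IsPrime] [𝔔.LiesOver 𝔭]
    [Algebra (Localization.AtPrime 𝔭) (Localization.AtPrime 𝔔)]
    [Localization.AtPrime.IsLiesOverAlgebra 𝔭 𝔔]
    (hflat : Module.Flat A (Localization.AtPrime 𝔔))
    (hfield : IsField (Localization.AtPrime 𝔔 ⧸ 𝔭.map (algebraMap A (Localization.AtPrime 𝔔))))
    [Algebra.IsSeparable 𝔭.ResidueField 𝔔.ResidueField] :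
    Algebra.IsEtaleAt A 𝔔 := by
  set Ap := Localization.AtPrime 𝔭 with hAp
  set Sq := Localization.AtPrime 𝔔 with hSq
  have hmax : 𝔭.map (algebraMap A Sq) = maximalIdeal Sq :=
    IsLocalRing.eq_maximalIdeal
      ((Ideal.Quotient.maximal_ideal_iff_isField_quotient _).mpr hfield)
  -- unramified at `𝔔`
  have hunr : Algebra.IsUnramifiedAt A 𝔔 :=
    (Algebra.isUnramifiedAt_iff_map_eq A 𝔭 𝔔).mpr ⟨inferInstance, hmax⟩
  -- flat and unramified over `A_𝔭`
  haveI : Module.Flat Ap Sq := (Module.flat_iff_of_isLocalization Ap 𝔭.primeCompl Sq).mpr hflat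
  haveI : Algebra.EssFiniteType Ap Sq := .of_comp A _ _
  haveI : Algebra.FormallyUnramified Ap Sq := .of_restrictScalars A _ _
  have hmax' : (maximalIdeal Ap).map (algebraMap Ap Sq) = maximalIdeal Sq := by
    rw [← Localization.AtPrime.map_eq_maximalIdeal, Ideal.map_map,
      ← IsScalarTower.algebraMap_eq]
    exact hmax
  haveI : Algebra.FormallySmooth (ResidueField Ap) (ResidueField Ap ⊗[Ap] Sq) :=
    formallySmooth_residueField_tensor_of_map_maximalIdeal hmax'
  -- `S_𝔔` is a localisation of the finitely presented `A_𝔭`-algebra `S_𝔭 = A_𝔭 ⊗_A S`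
  let Sp := Localization (Algebra.algebraMapSubmonoid S 𝔭.primeCompl)
  let f : Sp →ₐ[S] Sq := IsLocalization.liftAlgHom
    (M := Algebra.algebraMapSubmonoid S 𝔭.primeCompl) (f := Algebra.ofId _ _) (by
      rintro ⟨_, x, hx, rfl⟩
      simpa using! IsLocalization.map_units (M := 𝔔.primeCompl) Sq ⟨algebraMap _ _ x,
        by simp_all [𝔔.over_def 𝔭]⟩)
  algebraize [f.toRingHom]
  have : IsScalarTower A Sp Sq := .to₁₃₄ _ S _ _
  have : IsScalarTower Ap Sp Sq := .of_algebraMap_eq' <| by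
    apply IsLocalization.ringHom_ext 𝔭.primeCompl
    simp only [RingHom.comp_assoc, ← IsScalarTower.algebraMap_eq]
  have : IsLocalization (Algebra.algebraMapSubmonoid Sp 𝔔.primeCompl) Sq :=
    .isLocalization_of_submonoid_le _ _ (Algebra.algebraMapSubmonoid S 𝔭.primeCompl) _
    (by rintro _ ⟨x, hx, rfl⟩; simp_all [𝔔.over_def 𝔭])
  have : Algebra.FinitePresentation Ap Sp := by
    have : Algebra.IsPushout A Ap S Sp :=
      .symm <| Algebra.isPushout_of_isLocalization 𝔭.primeCompl _ _ _
    exact .equiv (Algebra.IsPushout.equiv A Ap S Sp)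
  have hfs : Algebra.FormallySmooth Ap Sq :=
    Algebra.FormallySmooth.of_formallySmooth_residueField_tensor (R := Ap) (S := Sq) (P := Sp)
      (Algebra.algebraMapSubmonoid Sp 𝔔.primeCompl)
  -- hence over `A`
  haveI : Algebra.FormallyEtale A Ap := .of_isLocalization 𝔭.primeCompl
  haveI : Algebra.FormallySmooth A Ap := inferInstance
  have hfsA : Algebra.FormallySmooth A Sq := Algebra.FormallySmooth.comp A Ap Sq
  exact Algebra.FormallyEtale.iff_formallyUnramified_and_formallySmooth.mpr ⟨hunr, hfsA⟩

end Literature.AlgebraicGeometry.Resolution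

end
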